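import Literature.NumberTheory.LFunctions.SuzukiScrewLineContinuationProofs
import Mathlib.NumberTheory.LSeries.Dirichlet
import HarnessLib

/-!
# Suzuki's screw line: the pinning step of CJM Prop 3.1 (`𝔓_t = P_t`)

LINE 1 — LABEL: RH-FREE support theorems (no fact is discharged or asserted here). Companion of
`SuzukiScrewLineContinuationProofs.lean` for `Literature.NumberTheory.LFunctions.Suzuki2025_prop31`
(M. Suzuki, Canad. J. Math. 2025 = arXiv:2301.00421v3, **Prop 3.1**). Weil's explicit formula
applied to the COMPACTLY supported combination `c_tφ_{z,t} − c_{t′}φ_{z,t′}`, `c_t = (e^{−izt}−1)⁻¹`,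
of the printed test functions only shows that `c_t(𝔓_t(z) − P_t(z))` is independent of `t > 0`
(the `ζ′/ζ(½−iz)`-term of (1.6) lives in the non-compact tail). This file supplies the missing
PINNING: for `Im z > 1` the quotient `(𝔓_t(z) − P_t(z))/(e^{−izt} − 1)` tends to `0` as
`t → +∞` (`ScrewPinning.tendsto_sub_div`), because `P_t(z) = O(e^{t/2})` while in (1.6) the two
terms of size `e^{t·Im z}` combine into `e^{−izt}(iz)⁻¹ · (−Σ_{n>e^t} Λ(n)n^{−s})`, `s = ½ − iz`
(a tail of the absolutely convergent Dirichlet series `−ζ′/ζ(s) = Σ Λ(n)n^{−s}`,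
Mathlib `LSeries_vonMangoldt_eq_deriv_riemannZeta_div`), and everything else is `O(t·e^t)`.
Hence a `t`-independent quotient vanishes, and with the continuation step
(`Suzuki2025_prop31_of_im_gt_one`) we obtain the interface theorem
`Suzuki2025_prop31_of_sub_eq_const_mul`. bears_on: B-C/B-P (COLUMN 6 DBR). WHAT THIS IS NOT: the
explicit-formula half of Prop 3.1 is not proved here; nothing here bears on the truth of RH.

## References

* M. Suzuki, *On the Hilbert space derived from the Weil distribution*, Canad. J. Math. (2025)
  = arXiv:2301.00421v3, §3.1: (3.2) and Prop 3.1 with its proof (TeX l.770–980). [Suzuki2025WeilHilbertSpace]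
-/

noncomputable section

open Filter Topology Finset Complex Set

namespace Literature.NumberTheory.LFunctions

namespace ScrewPinning

/-! ## Elementary limits -/

/-- `M(t+1)e^{−δt} → 0` for `δ > 0`. [folklore] -/
private theorem tendsto_mul_exp_neg {δ : ℝ} (hδ : 0 < δ) (M : ℝ) :
    Tendsto (fun t : ℝ ↦ M * (t + 1) * Real.exp (-(δ * t))) atTop (𝓝 0) := by
  have h1 : Tendsto (fun t : ℝ ↦ t * Real.exp (-(t * δ))) atTop (𝓝 0) := by
    have h := (Real.tendsto_pow_mul_exp_neg_atTop_nhds_zero 1).comp (tendsto_id.atTop_mul_const hδ)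
    have h' := h.const_mul (1 / δ)
    rw [mul_zero] at h'
    refine h'.congr fun t ↦ ?_
    simp only [Function.comp_def, pow_one, id]
    field_simp
  have h2 : Tendsto (fun t : ℝ ↦ Real.exp (-(t * δ))) atTop (𝓝 0) :=
    Real.tendsto_exp_neg_atTop_nhds_zero.comp (tendsto_id.atTop_mul_const hδ)
  have h := (h1.add h2).const_mul M
  rw [add_zero, mul_zero] at h
  refine h.congr fun t ↦ ?_
  rw [show -(δ * t) = -(t * δ) by ring]; ring

/-- `|e^{−izt}| = e^{t·Im z}`. [folklore] -/
private theorem norm_cexp_neg_I_mul (z : ℂ) (t : ℝ) :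
    ‖cexp (-(I * z * t))‖ = Real.exp (z.im * t) := by
  rw [Complex.norm_exp]
  congr 1
  simp

/-- `e^{izt} → 0` as `t → +∞` when `Im z > 0`. [folklore] -/
private theorem tendsto_cexp_I_mul {z : ℂ} (hz : 0 < z.im) :
    Tendsto (fun t : ℝ ↦ cexp (I * z * t)) atTop (𝓝 0) := by
  rw [tendsto_zero_iff_norm_tendsto_zero]
  have h : ∀ t : ℝ, ‖cexp (I * z * t)‖ = Real.exp (-(t * z.im)) := by
    intro t; rw [Complex.norm_exp]; congr 1; simp; ring
  simp_rw [h]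
  exact Real.tendsto_exp_neg_atTop_nhds_zero.comp (tendsto_id.atTop_mul_const hz)

/-- `e^{−izt}/(e^{−izt} − 1) → 1` as `t → +∞` when `Im z > 0`. [folklore] -/
private theorem tendsto_cexp_div {z : ℂ} (hz : 0 < z.im) :
    Tendsto (fun t : ℝ ↦ cexp (-(I * z * t)) / (cexp (-(I * z * t)) - 1)) atTop (𝓝 1) := by
  have h := tendsto_cexp_I_mul hz
  have h1 : Tendsto (fun t : ℝ ↦ 1 / (1 - cexp (I * z * t))) atTop (𝓝 (1 / (1 - 0))) :=
    tendsto_const_nhds.div (tendsto_const_nhds.sub h) (by simp)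
  rw [sub_zero, div_one] at h1
  refine h1.congr' ?_
  filter_upwards [eventually_gt_atTop (0 : ℝ)] with t ht
  have hmul : cexp (-(I * z * t)) * cexp (I * z * t) = 1 := by
    rw [← Complex.exp_add]; simp
  have hlt : ‖cexp (I * z * t)‖ < 1 := by
    rw [Complex.norm_exp, Real.exp_lt_one_iff]
    have : (I * z * (t : ℂ)).re = -(t * z.im) := by simp; ring
    rw [this]; nlinarith
  have hne1 : (1 : ℂ) - cexp (I * z * t) ≠ 0 := by
    intro h
    rw [sub_eq_zero] at h
    rw [← h, norm_one] at hlt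
    exact lt_irrefl _ hlt
  have hne2 : cexp (-(I * z * t)) - 1 ≠ 0 := by
    intro h
    rw [sub_eq_zero] at h
    rw [h, one_mul] at hmul
    exact hne1 (by rw [hmul, sub_self])
  rw [div_eq_div_iff hne1 hne2]
  linear_combination hmul

/-- The squeeze used for every small piece: if `‖f(t)‖ ≤ M(t+1)e^t` eventually, then
`f(t)/(e^{−izt} − 1) → 0` for `Im z > 1`. [folklore] -/
private theorem tendsto_div_of_le {z : ℂ} (hz : 1 < z.im) {f : ℝ → ℂ} {M : ℝ}
    (hf : ∀ᶠ t in atTop, ‖f t‖ ≤ M * (t + 1) * Real.exp t) :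
    Tendsto (fun t : ℝ ↦ f t / (cexp (-(I * z * t)) - 1)) atTop (𝓝 0) := by
  have hδ : 0 < z.im - 1 := by linarith
  refine squeeze_zero_norm' ?_ (tendsto_mul_exp_neg hδ (2 * M))
  have hbig : ∀ᶠ t : ℝ in atTop, 2 ≤ Real.exp (z.im * t) := by
    have ht : Tendsto (fun t : ℝ ↦ Real.exp (z.im * t)) atTop atTop :=
      Real.tendsto_exp_atTop.comp (tendsto_id.const_mul_atTop (by linarith))
    exact ht.eventually_ge_atTop 2
  filter_upwards [hf, hbig, eventually_ge_atTop (0 : ℝ)] with t hft h2 ht0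
  have hden : Real.exp (z.im * t) / 2 ≤ ‖cexp (-(I * z * t)) - 1‖ := by
    have h1 := norm_sub_norm_le (cexp (-(I * z * t))) 1
    rw [norm_cexp_neg_I_mul, norm_one] at h1
    linarith
  have hden_pos : 0 < ‖cexp (-(I * z * t)) - 1‖ := by
    have : 0 < Real.exp (z.im * t) := Real.exp_pos _
    linarith
  rw [norm_div, div_le_iff₀ hden_pos]
  have hM : M * (t + 1) * Real.exp t ≤ 2 * M * (t + 1) * Real.exp (-((z.im - 1) * t)) *
      (Real.exp (z.im * t) / 2) := by
    have : Real.exp (-((z.im - 1) * t)) * Real.exp (z.im * t) = Real.exp t := by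
      rw [← Real.exp_add]; ring_nf
    have hM' : M * (t + 1) * Real.exp t =
        2 * M * (t + 1) * Real.exp (-((z.im - 1) * t)) * (Real.exp (z.im * t) / 2) := by
      rw [show 2 * M * (t + 1) * Real.exp (-((z.im - 1) * t)) * (Real.exp (z.im * t) / 2) =
        M * (t + 1) * (Real.exp (-((z.im - 1) * t)) * Real.exp (z.im * t)) by ring, this]
    exact hM'.le
  calc ‖f t‖ ≤ M * (t + 1) * Real.exp t := hft
    _ ≤ 2 * M * (t + 1) * Real.exp (-((z.im - 1) * t)) * (Real.exp (z.im * t) / 2) := hM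
    _ ≤ 2 * M * (t + 1) * Real.exp (-((z.im - 1) * t)) * ‖cexp (-(I * z * t)) - 1‖ := by
        have hnn : 0 ≤ M * (t + 1) * Real.exp t := le_trans (norm_nonneg _) hft
        have h0 : 0 ≤ 2 * M * (t + 1) * Real.exp (-((z.im - 1) * t)) := by
          have hpos : 0 < (t + 1) * Real.exp t := by positivity
          have hM0 : 0 ≤ M := by
            by_contra hneg
            have hneg' : M < 0 := lt_of_not_ge hneg
            have : M * (t + 1) * Real.exp t < 0 := by
              have : M * ((t + 1) * Real.exp t) < 0 := mul_neg_of_neg_of_pos hneg' hpos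
              linarith [mul_assoc M (t + 1) (Real.exp t)]
            linarith
          positivity
        exact mul_le_mul_of_nonneg_left hden h0

/-! ## The growth of `P_t`: `‖P_t(z)‖ ≤ (e^{|t|/2}+1)·C(z)` -/

/-- For a non-trivial zero `ρ`: `|e^{−iγ(ρ)|t|} − 1| ≤ e^{|t|/2} + 1`. [folklore] -/
private theorem norm_cexp_zeroParam_le (t : ℝ) (ρ : ZetaZeros.riemannZetaNontrivialZeros) :
    ‖cexp (-(I * suzukiZeroParam (ρ : ℂ) * (|t| : ℝ))) - 1‖ ≤ Real.exp (|t| / 2) + 1 := by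
  obtain ⟨-, h0, h1⟩ := mem_riemannZetaNontrivialZeros_iff_holds.1 ρ.2
  have hre : (-(I * suzukiZeroParam (ρ : ℂ) * (|t| : ℝ))).re = ((ρ : ℂ).re - 1 / 2) * |t| := by
    simp [suzukiZeroParam]; ring
  calc ‖cexp (-(I * suzukiZeroParam (ρ : ℂ) * (|t| : ℝ))) - 1‖
      ≤ ‖cexp (-(I * suzukiZeroParam (ρ : ℂ) * (|t| : ℝ)))‖ + ‖(1 : ℂ)‖ := norm_sub_le _ _
    _ = Real.exp (((ρ : ℂ).re - 1 / 2) * |t|) + 1 := by rw [Complex.norm_exp, hre, norm_one]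
    _ ≤ Real.exp (|t| / 2) + 1 := by
        gcongr
        nlinarith [abs_nonneg t]

/-- `0 < |Im ρ| ≤ |γ(ρ)|` and `Im γ(ρ) < ½` for a non-trivial zero. [folklore] -/
private theorem zeroParam_facts (ρ : ZetaZeros.riemannZetaNontrivialZeros) :
    0 < |((ρ : ℂ)).im| ∧ |((ρ : ℂ)).im| ≤ ‖suzukiZeroParam (ρ : ℂ)‖ ∧
      (suzukiZeroParam (ρ : ℂ)).im < 1 / 2 := by
  obtain ⟨hζ, h0, h1⟩ := mem_riemannZetaNontrivialZeros_iff_holds.1 ρ.2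
  refine ⟨abs_pos.2 (im_ne_zero_of_riemannZeta_eq_zero hζ h0 h1), ?_, ?_⟩
  · have h := Complex.abs_re_le_norm (suzukiZeroParam (ρ : ℂ))
    have : (suzukiZeroParam (ρ : ℂ)).re = -((ρ : ℂ)).im := by simp [suzukiZeroParam]
    rwa [this, abs_neg] at h
  · rw [suzukiZeroParam_im]; linarith

/-- **`P_t(z) = O(e^{|t|/2})` for fixed `z` with `Im z > 1`**: `‖P_t(z)‖ ≤ (e^{|t|/2} + 1)·C(z)` with
`C(z) = Σ_ρ m(ρ)/(|γ||z − γ|) < ∞` (absolute convergence of (3.2) off `Γ`).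
[cite: Suzuki2025WeilHilbertSpace, §3.1, text after (3.2) (TeX l.779–787)] -/
theorem norm_screwZeroExpansion_le {z : ℂ} (hz : 1 < z.im) :
    ∃ C : ℝ, ∀ t : ℝ, ‖screwZeroExpansion t z‖ ≤ (Real.exp (|t| / 2) + 1) * C := by
  obtain ⟨w, hw⟩ : ∃ w : ZetaZeros.riemannZetaNontrivialZeros → ℝ,
      w = fun ρ : ZetaZeros.riemannZetaNontrivialZeros ↦ (riemannZetaZeroOrder (ρ : ℂ) : ℝ) /
        (‖suzukiZeroParam (ρ : ℂ)‖ * ‖z - suzukiZeroParam (ρ : ℂ)‖) :=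
    ⟨_, rfl⟩
  -- distance from `z` to `Γ`
  have hdist : ∀ ρ : ZetaZeros.riemannZetaNontrivialZeros, 1 / 2 ≤ ‖z - suzukiZeroParam (ρ : ℂ)‖ := by
    intro ρ
    have h := Complex.abs_im_le_norm (z - suzukiZeroParam (ρ : ℂ))
    have him : (z - suzukiZeroParam (ρ : ℂ)).im = z.im - (suzukiZeroParam (ρ : ℂ)).im := by simp
    rw [him] at h
    have := (zeroParam_facts ρ).2.2
    exact le_trans (by linarith [le_abs_self (z.im - (suzukiZeroParam (ρ : ℂ)).im)]) h
  have hw0 : ∀ ρ, 0 ≤ w ρ := fun ρ ↦ by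
    rw [hw]; exact div_nonneg (ZetaZeroSum.zeroOrder_nonneg ρ) (by positivity)
  -- summability of `w`: far zeros dominated by `4 m/(1 + Im ρ²)`
  obtain ⟨R, hR⟩ : ∃ R : ℝ, R = 2 * (‖z‖ + 2) := ⟨_, rfl⟩
  have hfar : ∀ ρ : ZetaZeros.riemannZetaNontrivialZeros, ρ ∉ weilZeroFinset R →
      w ρ ≤ 4 * ((riemannZetaZeroOrder (ρ : ℂ) : ℝ) / (1 + ((ρ : ℂ)).im ^ 2)) := by
    intro ρ hρ
    rw [mem_weilZeroFinset, not_le] at hρ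
    obtain ⟨him0, hγ, -⟩ := zeroParam_facts ρ
    have him1 : 1 ≤ |((ρ : ℂ)).im| := by linarith [norm_nonneg z]
    have hzγ : |((ρ : ℂ)).im| / 2 ≤ ‖z - suzukiZeroParam (ρ : ℂ)‖ := by
      have h1 := norm_sub_norm_le (suzukiZeroParam (ρ : ℂ)) z
      rw [norm_sub_rev] at h1
      linarith [norm_nonneg z]
    have hm0 : (0 : ℝ) ≤ riemannZetaZeroOrder (ρ : ℂ) := ZetaZeroSum.zeroOrder_nonneg ρ
    have him2 : 0 < ((ρ : ℂ)).im ^ 2 := by have := sq_abs ((ρ : ℂ)).im; nlinarith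
    rw [hw]
    calc (riemannZetaZeroOrder (ρ : ℂ) : ℝ) / (‖suzukiZeroParam (ρ : ℂ)‖ * ‖z - suzukiZeroParam (ρ : ℂ)‖)
        ≤ (riemannZetaZeroOrder (ρ : ℂ) : ℝ) / (|((ρ : ℂ)).im| * (|((ρ : ℂ)).im| / 2)) := by
          gcongr
      _ = (riemannZetaZeroOrder (ρ : ℂ) : ℝ) * (2 / ((ρ : ℂ)).im ^ 2) := by
          rw [← sq_abs]; field_simp
      _ ≤ (riemannZetaZeroOrder (ρ : ℂ) : ℝ) * (4 / (1 + ((ρ : ℂ)).im ^ 2)) := by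
          refine mul_le_mul_of_nonneg_left ?_ hm0
          rw [div_le_div_iff₀ him2 (by positivity)]
          nlinarith [sq_abs (ρ : ℂ).im]
      _ = 4 * ((riemannZetaZeroOrder (ρ : ℂ) : ℝ) / (1 + ((ρ : ℂ)).im ^ 2)) := by ring
  have hwsum : Summable w := by
    refine (Finset.summable_compl_iff (weilZeroFinset R)).1 ?_
    have hu : Summable fun ρ : {ρ : ZetaZeros.riemannZetaNontrivialZeros // ρ ∉ weilZeroFinset R} ↦
        4 * ((riemannZetaZeroOrder ((ρ : ZetaZeros.riemannZetaNontrivialZeros) : ℂ) : ℝ) /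
          (1 + (((ρ : ZetaZeros.riemannZetaNontrivialZeros) : ℂ)).im ^ 2)) :=
      (ZetaZeroSum.summable_zeroOrder_div_one_add_sq.mul_left 4).comp_injective Subtype.val_injective
    exact hu.of_nonneg_of_le (fun ρ ↦ hw0 ρ) (fun ρ ↦ hfar ρ ρ.2)
  refine ⟨∑' ρ, w ρ, fun t ↦ ?_⟩
  -- termwise bound
  have hterm : ∀ ρ : ZetaZeros.riemannZetaNontrivialZeros,
      ‖(riemannZetaZeroOrder (ρ : ℂ) : ℂ) *
          ((cexp (-(I * suzukiZeroParam (ρ : ℂ) * (|t| : ℝ))) - 1) / suzukiZeroParam (ρ : ℂ)) *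
          (1 / (z - suzukiZeroParam (ρ : ℂ)))‖ ≤ (Real.exp (|t| / 2) + 1) * w ρ := by
    intro ρ
    have hm0 : (0 : ℝ) ≤ riemannZetaZeroOrder (ρ : ℂ) := ZetaZeroSum.zeroOrder_nonneg ρ
    rw [norm_mul, norm_mul, norm_div, norm_div, norm_one, Complex.norm_intCast, abs_of_nonneg hm0, hw]
    have hE := norm_cexp_zeroParam_le t ρ
    calc (riemannZetaZeroOrder (ρ : ℂ) : ℝ) *
          (‖cexp (-(I * suzukiZeroParam (ρ : ℂ) * (|t| : ℝ))) - 1‖ / ‖suzukiZeroParam (ρ : ℂ)‖) *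
          (1 / ‖z - suzukiZeroParam (ρ : ℂ)‖)
        ≤ (riemannZetaZeroOrder (ρ : ℂ) : ℝ) *
          ((Real.exp (|t| / 2) + 1) / ‖suzukiZeroParam (ρ : ℂ)‖) * (1 / ‖z - suzukiZeroParam (ρ : ℂ)‖) := by
          gcongr
      _ = (Real.exp (|t| / 2) + 1) * ((riemannZetaZeroOrder (ρ : ℂ) : ℝ) /
          (‖suzukiZeroParam (ρ : ℂ)‖ * ‖z - suzukiZeroParam (ρ : ℂ)‖)) := by
          by_cases hγ : ‖suzukiZeroParam (ρ : ℂ)‖ = 0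
          · simp [hγ]
          · have hzγ : ‖z - suzukiZeroParam (ρ : ℂ)‖ ≠ 0 := by
              have := hdist ρ; intro h; rw [h] at this; linarith
            field_simp
  have h := tsum_of_norm_bounded ((hwsum.mul_left (Real.exp (|t| / 2) + 1)).hasSum) hterm
  rw [tsum_mul_left] at h
  exact h



/-! ## The explicit-formula side: the `ζ′/ζ`-term and the prime sum of (1.6) -/

/-- Termwise: `Λ(n)n^{−1/2}(e^{−iz(t − log n)} − 1)/(iz) = (iz)⁻¹ (e^{−izt} Λ(n) n^{−s} − Λ(n)n^{−1/2})`,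
`s = ½ − iz`. [folklore] -/
private theorem prime_term_eq (z : ℂ) (t : ℝ) {n : ℕ} (hn : n ≠ 0) :
    ((ArithmeticFunction.vonMangoldt n / Real.sqrt n : ℝ) : ℂ) *
        ((cexp (-(I * z * ((t - Real.log n : ℝ) : ℂ))) - 1) / (I * z)) =
      (I * z)⁻¹ * (cexp (-(I * z * t)) *
        LSeries.term (fun n ↦ (ArithmeticFunction.vonMangoldt n : ℂ)) (1 / 2 - I * z) n -
        ((ArithmeticFunction.vonMangoldt n / Real.sqrt n : ℝ) : ℂ)) := by
  have hn0 : (0 : ℝ) < n := by exact_mod_cast Nat.pos_of_ne_zero hn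
  have hsq : ((ArithmeticFunction.vonMangoldt n / Real.sqrt n : ℝ) : ℂ) =
      (ArithmeticFunction.vonMangoldt n : ℂ) * cexp (-((Real.log n : ℝ) : ℂ) / 2) := by
    rw [Real.sqrt_eq_rpow, Real.rpow_def_of_pos hn0]
    push_cast
    rw [div_eq_mul_inv, ← Complex.exp_neg]
    congr 2
    ring
  have hpow : ((n : ℕ) : ℂ) ^ (1 / 2 - I * z) = cexp (((Real.log n : ℝ) : ℂ) * (1 / 2 - I * z)) := by
    rw [Complex.cpow_def_of_ne_zero (by exact_mod_cast hn), Complex.natCast_log]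
  have key : cexp (-((Real.log n : ℝ) : ℂ) / 2) * cexp (-(I * z * ((t - Real.log n : ℝ) : ℂ))) =
      cexp (-(I * z * t)) / cexp (((Real.log n : ℝ) : ℂ) * (1 / 2 - I * z)) := by
    rw [← Complex.exp_add, ← Complex.exp_sub]
    congr 1
    push_cast
    ring
  rw [LSeries.term_of_ne_zero hn, hsq, hpow]
  rw [show cexp (-(I * z * t)) * ((ArithmeticFunction.vonMangoldt n : ℂ) /
      cexp (((Real.log n : ℝ) : ℂ) * (1 / 2 - I * z))) = (ArithmeticFunction.vonMangoldt n : ℂ) *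
      (cexp (-((Real.log n : ℝ) : ℂ) / 2) * cexp (-(I * z * ((t - Real.log n : ℝ) : ℂ)))) by
    rw [key]; ring]
  rw [div_eq_mul_inv _ (I * z)]
  ring

/-- The `ζ′/ζ`-term plus the prime sum of (1.6), rewritten with the Dirichlet series
`−ζ′/ζ(s) = Σ Λ(n)n^{−s}` (`s = ½ − iz`, `Re s > 1`). [folklore] -/
private theorem zeta_terms_eq {z : ℂ} (hz : 1 < z.im) (t : ℝ) (N : ℕ) :
    (cexp (-(I * z * t)) - 1) / (I * z) *
          (deriv riemannZeta (1 / 2 - I * z) / riemannZeta (1 / 2 - I * z)) +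
        ∑ n ∈ Finset.Icc 1 N, ((ArithmeticFunction.vonMangoldt n / Real.sqrt n : ℝ) : ℂ) *
          ((cexp (-(I * z * ((t - Real.log n : ℝ) : ℂ))) - 1) / (I * z)) =
      (I * z)⁻¹ *
        (-(cexp (-(I * z * t)) *
            (LSeries (fun n ↦ (ArithmeticFunction.vonMangoldt n : ℂ)) (1 / 2 - I * z) -
              ∑ n ∈ Finset.Icc 1 N,
                LSeries.term (fun n ↦ (ArithmeticFunction.vonMangoldt n : ℂ)) (1 / 2 - I * z) n)) +
          (LSeries (fun n ↦ (ArithmeticFunction.vonMangoldt n : ℂ)) (1 / 2 - I * z) -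
            ∑ n ∈ Finset.Icc 1 N, ((ArithmeticFunction.vonMangoldt n / Real.sqrt n : ℝ) : ℂ))) := by
  have hs : 1 < (1 / 2 - I * z).re := by simp; linarith
  have hL := ArithmeticFunction.LSeries_vonMangoldt_eq_deriv_riemannZeta_div hs
  have hζ : deriv riemannZeta (1 / 2 - I * z) / riemannZeta (1 / 2 - I * z) =
      -LSeries (fun n ↦ (ArithmeticFunction.vonMangoldt n : ℂ)) (1 / 2 - I * z) := by
    rw [hL]; ring
  rw [hζ, Finset.sum_congr rfl fun n hn ↦ prime_term_eq z t (by
    have := (Finset.mem_Icc.1 hn).1; omega), ← Finset.mul_sum, Finset.sum_sub_distrib,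
    ← Finset.mul_sum]
  rw [div_eq_mul_inv _ (I * z)]
  ring

/-- The Dirichlet-series tail `Σ_{n > e^t} Λ(n) n^{−s} → 0` as `t → +∞` (`Re s > 1`). [folklore] -/
private theorem tendsto_LSeries_tail {s : ℂ} (hs : 1 < s.re) :
    Tendsto (fun t : ℝ ↦ LSeries (fun n ↦ (ArithmeticFunction.vonMangoldt n : ℂ)) s -
      ∑ n ∈ Finset.Icc 1 ⌊Real.exp t⌋₊,
        LSeries.term (fun n ↦ (ArithmeticFunction.vonMangoldt n : ℂ)) s n) atTop (𝓝 0) := by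
  have hsum := ArithmeticFunction.LSeriesSummable_vonMangoldt hs
  have h1 : Tendsto (fun N : ℕ ↦ ∑ n ∈ Finset.range N,
      LSeries.term (fun n ↦ (ArithmeticFunction.vonMangoldt n : ℂ)) s n) atTop
      (𝓝 (LSeries (fun n ↦ (ArithmeticFunction.vonMangoldt n : ℂ)) s)) :=
    hsum.hasSum.tendsto_sum_nat
  have h2 : Tendsto (fun N : ℕ ↦ ∑ n ∈ Finset.Icc 1 N,
      LSeries.term (fun n ↦ (ArithmeticFunction.vonMangoldt n : ℂ)) s n) atTop
      (𝓝 (LSeries (fun n ↦ (ArithmeticFunction.vonMangoldt n : ℂ)) s)) := by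
    refine (h1.comp (tendsto_add_atTop_nat 1)).congr fun N ↦ ?_
    simp only [Function.comp_def]
    symm
    refine Finset.sum_subset (fun n hn ↦ ?_) (fun n hn hn' ↦ ?_)
    · rw [Finset.mem_range]; rw [Finset.mem_Icc] at hn; omega
    · rw [Finset.mem_range] at hn; rw [Finset.mem_Icc] at hn'
      have : n = 0 := by omega
      rw [this, LSeries.term_zero]
  have h3 := h2.comp (tendsto_nat_floor_atTop.comp Real.tendsto_exp_atTop)
  have h4 := (tendsto_const_nhds
    (x := LSeries (fun n ↦ (ArithmeticFunction.vonMangoldt n : ℂ)) s)).sub h3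
  rw [sub_self] at h4
  exact h4

/-- `|Σ_{n ≤ e^t} Λ(n)/√n| ≤ t·e^t` for `t ≥ 0` (trivial Chebyshev-type bound). [folklore] -/
private theorem norm_chebyshev_sum_le {t : ℝ} (ht : 0 ≤ t) :
    ‖∑ n ∈ Finset.Icc 1 ⌊Real.exp t⌋₊,
      ((ArithmeticFunction.vonMangoldt n / Real.sqrt n : ℝ) : ℂ)‖ ≤ t * Real.exp t := by
  rw [← Complex.ofReal_sum, Complex.norm_real, Real.norm_of_nonneg (Finset.sum_nonneg fun n _ ↦
    div_nonneg ArithmeticFunction.vonMangoldt_nonneg (Real.sqrt_nonneg _))]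
  have hN : (⌊Real.exp t⌋₊ : ℝ) ≤ Real.exp t := Nat.floor_le (Real.exp_pos t).le
  have hterm : ∀ n ∈ Finset.Icc 1 ⌊Real.exp t⌋₊, ArithmeticFunction.vonMangoldt n / Real.sqrt n ≤ t := by
    intro n hn
    obtain ⟨h1, h2⟩ := Finset.mem_Icc.1 hn
    have hn1 : (1 : ℝ) ≤ n := by exact_mod_cast h1
    have hn2 : (n : ℝ) ≤ ⌊Real.exp t⌋₊ := by exact_mod_cast h2
    calc ArithmeticFunction.vonMangoldt n / Real.sqrt n
        ≤ ArithmeticFunction.vonMangoldt n :=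
          div_le_self ArithmeticFunction.vonMangoldt_nonneg (Real.one_le_sqrt.2 hn1)
      _ ≤ Real.log n := ArithmeticFunction.vonMangoldt_le_log
      _ ≤ Real.log (Real.exp t) := Real.log_le_log (by positivity) (hn2.trans hN)
      _ = t := Real.log_exp t
  calc ∑ n ∈ Finset.Icc 1 ⌊Real.exp t⌋₊, ArithmeticFunction.vonMangoldt n / Real.sqrt n
      ≤ ∑ n ∈ Finset.Icc 1 ⌊Real.exp t⌋₊, t := Finset.sum_le_sum hterm
    _ = ⌊Real.exp t⌋₊ * t := by simp
    _ ≤ Real.exp t * t := by gcongr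
    _ = t * Real.exp t := mul_comm _ _

/-- `‖B(t, z)‖ ≤ B₀(z)` uniformly in `t` (for `Im z > 1`). [folklore] -/
private theorem norm_screwLerchBracket_le {z : ℂ} (hz : 1 < z.im) :
    ∃ B : ℝ, ∀ t : ℝ, ‖screwLerchBracket t z‖ ≤ B := by
  obtain ⟨w, hw⟩ : ∃ w : ℂ, w = (1 / 2 - I * z) / 2 := ⟨_, rfl⟩
  have hwre : w.re = 1 / 4 + z.im / 2 := by rw [hw]; simp; ring
  obtain ⟨g, hg⟩ : ∃ g : ℕ → ℝ, g = fun n : ℕ ↦ 16 * ‖1 / 4 - w‖ / ((n : ℝ) + 1) ^ 2 := ⟨_, rfl⟩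
  have hgs : Summable g := by
    have h1 : Summable (fun m : ℕ ↦ 1 / ((m + 1 : ℕ) : ℝ) ^ 2) :=
      (summable_nat_add_iff 1).mpr (Real.summable_one_div_nat_pow.mpr one_lt_two)
    have h2 := h1.mul_left (16 * ‖1 / 4 - w‖)
    rw [hg]
    refine h2.congr fun m ↦ ?_
    push_cast; ring
  refine ⟨∑' n, g n, fun t ↦ ?_⟩
  unfold screwLerchBracket
  rw [← hw]
  refine tsum_of_norm_bounded hgs.hasSum fun n ↦ ?_
  have hn0 : (0 : ℝ) ≤ n := n.cast_nonneg
  have hn4 : (n : ℂ) + 1 / 4 ≠ 0 := by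
    intro h; have := congrArg Complex.re h; simp at this; linarith
  have hnw : (n : ℂ) + w ≠ 0 := by
    intro h; have := congrArg Complex.re h; simp [hwre] at this; linarith
  rw [norm_mul, Complex.norm_real, Real.norm_of_nonneg (Real.exp_pos _).le]
  have hexp : Real.exp (-(2 * |t| * n)) ≤ 1 := by
    rw [Real.exp_le_one_iff]; have := abs_nonneg t; nlinarith
  have hpos : 0 < (n : ℝ) + 1 / 4 := by positivity
  have hdiff : ‖1 / ((n : ℂ) + w) - 1 / ((n : ℂ) + 1 / 4)‖ ≤ g n := by
    rw [div_sub_div _ _ hnw hn4, norm_div, norm_mul]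
    have hA : ‖(n : ℂ) + 1 / 4‖ = n + 1 / 4 := by
      rw [show (n : ℂ) + 1 / 4 = ((n + 1 / 4 : ℝ) : ℂ) by push_cast; ring,
        Complex.norm_of_nonneg hpos.le]
    have hB : (n : ℝ) + 1 / 4 ≤ ‖(n : ℂ) + w‖ := by
      have h := Complex.abs_re_le_norm ((n : ℂ) + w)
      have : ((n : ℂ) + w).re = n + w.re := by simp
      rw [this, hwre, abs_of_nonneg (by linarith)] at h
      linarith
    have hnum : ‖1 * ((n : ℂ) + 1 / 4) - ((n : ℂ) + w) * 1‖ = ‖1 / 4 - w‖ := by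
      congr 1; ring
    rw [hnum, hA, hg]
    rw [div_le_div_iff₀ (mul_pos (norm_pos_iff.2 hnw) hpos) (by positivity)]
    have h0 : 0 ≤ ‖1 / 4 - w‖ := norm_nonneg _
    have h1 : ((n : ℝ) + 1) ^ 2 ≤ 16 * (((n : ℝ) + 1 / 4) * ((n : ℝ) + 1 / 4)) := by nlinarith
    have h2 : ((n : ℝ) + 1 / 4) * ((n : ℝ) + 1 / 4) ≤ ‖(n : ℂ) + w‖ * ((n : ℝ) + 1 / 4) :=
      mul_le_mul_of_nonneg_right hB hpos.le
    have h3 : ((n : ℝ) + 1) ^ 2 ≤ 16 * (‖(n : ℂ) + w‖ * ((n : ℝ) + 1 / 4)) :=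
      h1.trans (by nlinarith [h2])
    calc ‖1 / 4 - w‖ * (((n : ℝ) + 1) ^ 2) ≤ ‖1 / 4 - w‖ * (16 * (‖(n : ℂ) + w‖ * ((n : ℝ) + 1 / 4))) :=
          mul_le_mul_of_nonneg_left h3 h0
      _ = 16 * ‖1 / 4 - w‖ * (‖(n : ℂ) + w‖ * ((n : ℝ) + 1 / 4)) := by ring
  calc Real.exp (-(2 * |t| * n)) * ‖1 / ((n : ℂ) + w) - 1 / ((n : ℂ) + 1 / 4)‖
      ≤ 1 * g n := mul_le_mul hexp hdiff (norm_nonneg _) zero_le_one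
    _ = g n := one_mul _

/-! ## The pinning limit and the interface theorems -/

/-- `1 ≤ (t+1)e^t` and `e^{t/2} ≤ (t+1)e^t` for `t ≥ 0`. [folklore] -/
private theorem aux_exp {t : ℝ} (ht : 0 ≤ t) :
    1 ≤ (t + 1) * Real.exp t ∧ Real.exp (t / 2) ≤ (t + 1) * Real.exp t := by
  have h1 : 1 ≤ Real.exp t := Real.one_le_exp ht
  have h2 : Real.exp (t / 2) ≤ Real.exp t := Real.exp_le_exp.2 (by linarith)
  have h3 : 0 < Real.exp (t / 2) := Real.exp_pos _
  constructor <;> nlinarith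

/-- **Pinning limit.** For `Im z > 1`: `(𝔓_t(z) − P_t(z))/(e^{−izt} − 1) → 0` as `t → +∞` — in (1.6)
the two terms of size `e^{t·Im z}` combine into `e^{−izt}(iz)⁻¹·(−Σ_{n>e^t} Λ(n)n^{−s})`, and all other
terms, as well as `P_t(z)`, are `O(t e^t)`. (Formalisation device: it replaces the printed step «Weil's
explicit formula can be applied to `φ = φ_{z,t}`» (TeX l.826), the tree's explicit formula being stated for
compactly supported test functions.) [cite: Suzuki2025WeilHilbertSpace, Prop. 3.1 proof (TeX l.794–980)] -/
theorem tendsto_sub_div {z : ℂ} (hz : 1 < z.im) :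
    Tendsto (fun t : ℝ ↦ (screwP t z - screwZeroExpansion t z) / (cexp (-(I * z * t)) - 1))
      atTop (𝓝 0) := by
  have hz0 : 0 < z.im := by linarith
  have hs : 1 < (1 / 2 - I * z).re := by simp; linarith
  -- names for the pieces of (1.6)
  obtain ⟨L, hL⟩ : ∃ L : ℂ, L = LSeries (fun n ↦ (ArithmeticFunction.vonMangoldt n : ℂ)) (1 / 2 - I * z) :=
    ⟨_, rfl⟩
  obtain ⟨S, hS⟩ : ∃ S : ℝ → ℂ, S = fun t : ℝ ↦ ∑ n ∈ Finset.Icc 1 ⌊Real.exp t⌋₊,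
      LSeries.term (fun n ↦ (ArithmeticFunction.vonMangoldt n : ℂ)) (1 / 2 - I * z) n := ⟨_, rfl⟩
  obtain ⟨C, hC⟩ : ∃ C : ℝ → ℂ, C = fun t : ℝ ↦ ∑ n ∈ Finset.Icc 1 ⌊Real.exp t⌋₊,
      ((ArithmeticFunction.vonMangoldt n / Real.sqrt n : ℝ) : ℂ) := ⟨_, rfl⟩
  obtain ⟨A1, hA1⟩ : ∃ A1 : ℝ → ℂ, A1 = fun t : ℝ ↦
      4 * ((Real.exp (t / 2) - 1 : ℝ) : ℂ) / (1 + 2 * I * z) := ⟨_, rfl⟩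
  obtain ⟨A2, hA2⟩ : ∃ A2 : ℝ → ℂ, A2 = fun t : ℝ ↦
      4 * ((Real.exp (-(t / 2)) - 1 : ℝ) : ℂ) / (1 - 2 * I * z) := ⟨_, rfl⟩
  obtain ⟨A5, hA5⟩ : ∃ A5 : ℂ, A5 =
      1 / (2 * I * z) * (Complex.digamma (1 / 4 - I * z / 2) - Complex.digamma (1 / 4)) := ⟨_, rfl⟩
  obtain ⟨A6, hA6⟩ : ∃ A6 : ℝ → ℂ, A6 = fun t : ℝ ↦
      1 / (2 * I * z) * ((Real.exp (-(t / 2)) : ℝ) : ℂ) * screwLerchBracket t z := ⟨_, rfl⟩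
  -- the decomposition of `𝔓_t(z) − P_t(z)` for `t > 0`
  have hdec : ∀ t : ℝ, 0 < t → screwP t z - screwZeroExpansion t z =
      A1 t + A2 t + (I * z)⁻¹ * (L - C t) - A5 - A6 t - screwZeroExpansion t z +
        (I * z)⁻¹ * (-cexp (-(I * z * t)) * (L - S t)) := by
    intro t ht
    have hid := zeta_terms_eq hz t ⌊Real.exp t⌋₊
    rw [hA1, hA2, hA5, hA6, hL, hS, hC]
    simp only [screwP, abs_of_pos ht]
    linear_combination hid
  -- (a) `A1/(E−1) → 0`
  have h1 : Tendsto (fun t : ℝ ↦ A1 t / (cexp (-(I * z * t)) - 1)) atTop (𝓝 0) := by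
    refine tendsto_div_of_le hz (M := 4 / ‖1 + 2 * I * z‖) ?_
    filter_upwards [eventually_ge_atTop (0 : ℝ)] with t ht
    rw [hA1]
    simp only
    rw [norm_div, norm_mul, Complex.norm_real, Complex.norm_ofNat,
      Real.norm_of_nonneg (by linarith [Real.one_le_exp (by linarith : 0 ≤ t / 2)])]
    have := (aux_exp ht).2
    have hden : 0 ≤ ‖1 + 2 * I * z‖ := norm_nonneg _
    by_cases h0 : ‖1 + 2 * I * z‖ = 0
    · rw [h0]; simp
    · have hpos : 0 < ‖1 + 2 * I * z‖ := lt_of_le_of_ne hden (Ne.symm h0)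
      rw [div_le_iff₀ hpos]
      calc 4 * (Real.exp (t / 2) - 1) ≤ 4 * ((t + 1) * Real.exp t) := by linarith
        _ = 4 / ‖1 + 2 * I * z‖ * (t + 1) * Real.exp t * ‖1 + 2 * I * z‖ := by
            field_simp
  -- (b) `A2/(E−1) → 0`
  have h2 : Tendsto (fun t : ℝ ↦ A2 t / (cexp (-(I * z * t)) - 1)) atTop (𝓝 0) := by
    refine tendsto_div_of_le hz (M := 4 / ‖1 - 2 * I * z‖) ?_
    filter_upwards [eventually_ge_atTop (0 : ℝ)] with t ht
    rw [hA2]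
    simp only
    rw [norm_div, norm_mul, Complex.norm_real, Complex.norm_ofNat]
    have hle : ‖Real.exp (-(t / 2)) - 1‖ ≤ 1 := by
      rw [Real.norm_eq_abs, abs_sub_comm, abs_of_nonneg (by
        linarith [Real.exp_le_one_iff.2 (by linarith : -(t / 2) ≤ 0)])]
      linarith [Real.exp_pos (-(t / 2))]
    have := (aux_exp ht).1
    have hden : 0 ≤ ‖1 - 2 * I * z‖ := norm_nonneg _
    by_cases h0 : ‖1 - 2 * I * z‖ = 0
    · rw [h0]; simp
    · have hpos : 0 < ‖1 - 2 * I * z‖ := lt_of_le_of_ne hden (Ne.symm h0)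
      rw [div_le_iff₀ hpos]
      calc 4 * ‖Real.exp (-(t / 2)) - 1‖ ≤ 4 * ((t + 1) * Real.exp t) := by nlinarith
        _ = 4 / ‖1 - 2 * I * z‖ * (t + 1) * Real.exp t * ‖1 - 2 * I * z‖ := by
            field_simp
  -- (c) `(iz)⁻¹(L − C_N)/(E−1) → 0`
  have h3 : Tendsto (fun t : ℝ ↦ (I * z)⁻¹ * (L - C t) / (cexp (-(I * z * t)) - 1)) atTop (𝓝 0) := by
    refine tendsto_div_of_le hz (M := ‖(I * z)⁻¹‖ * (‖L‖ + 1)) ?_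
    filter_upwards [eventually_ge_atTop (0 : ℝ)] with t ht
    rw [norm_mul]
    have hCt : ‖C t‖ ≤ t * Real.exp t := by rw [hC]; exact norm_chebyshev_sum_le ht
    have hLC : ‖L - C t‖ ≤ ‖L‖ + t * Real.exp t := (norm_sub_le _ _).trans (by linarith)
    have := (aux_exp ht).1
    have hL0 : 0 ≤ ‖L‖ := norm_nonneg _
    calc ‖(I * z)⁻¹‖ * ‖L - C t‖ ≤ ‖(I * z)⁻¹‖ * (‖L‖ + t * Real.exp t) :=
          mul_le_mul_of_nonneg_left hLC (norm_nonneg _)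
      _ ≤ ‖(I * z)⁻¹‖ * ((‖L‖ + 1) * ((t + 1) * Real.exp t)) := by
          refine mul_le_mul_of_nonneg_left ?_ (norm_nonneg _)
          nlinarith [Real.exp_pos t]
      _ = ‖(I * z)⁻¹‖ * (‖L‖ + 1) * (t + 1) * Real.exp t := by ring
  -- (d) the digamma term
  have h5 : Tendsto (fun t : ℝ ↦ A5 / (cexp (-(I * z * t)) - 1)) atTop (𝓝 0) := by
    refine tendsto_div_of_le hz (M := ‖A5‖) ?_
    filter_upwards [eventually_ge_atTop (0 : ℝ)] with t ht
    have := (aux_exp ht).1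
    nlinarith [norm_nonneg A5]
  -- (e) the Lerch term
  have h6 : Tendsto (fun t : ℝ ↦ A6 t / (cexp (-(I * z * t)) - 1)) atTop (𝓝 0) := by
    obtain ⟨B, hB⟩ := norm_screwLerchBracket_le hz
    have hB0 : 0 ≤ B := (norm_nonneg _).trans (hB 0)
    refine tendsto_div_of_le hz (M := ‖1 / (2 * I * z)‖ * B) ?_
    filter_upwards [eventually_ge_atTop (0 : ℝ)] with t ht
    rw [hA6]
    simp only
    rw [norm_mul, norm_mul, Complex.norm_real, Real.norm_of_nonneg (Real.exp_pos _).le]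
    have hexp : Real.exp (-(t / 2)) ≤ 1 := Real.exp_le_one_iff.2 (by linarith)
    have := (aux_exp ht).1
    have hn0 : 0 ≤ ‖1 / (2 * I * z)‖ := norm_nonneg _
    calc ‖1 / (2 * I * z)‖ * Real.exp (-(t / 2)) * ‖screwLerchBracket t z‖
        ≤ ‖1 / (2 * I * z)‖ * 1 * B := by
          gcongr
          exact hB t
      _ ≤ ‖1 / (2 * I * z)‖ * B * (t + 1) * Real.exp t := by nlinarith [mul_nonneg hn0 hB0]
  -- (f) `P_t(z)/(E−1) → 0`
  have hP : Tendsto (fun t : ℝ ↦ screwZeroExpansion t z / (cexp (-(I * z * t)) - 1)) atTop (𝓝 0) := by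
    obtain ⟨Cz, hCz⟩ := norm_screwZeroExpansion_le hz
    have hC0 : 0 ≤ Cz := by
      have h := (norm_nonneg _).trans (hCz 0)
      have : (0 : ℝ) < Real.exp (|0| / 2) + 1 := by positivity
      nlinarith
    refine tendsto_div_of_le hz (M := 2 * Cz) ?_
    filter_upwards [eventually_ge_atTop (0 : ℝ)] with t ht
    have h := hCz t
    rw [abs_of_nonneg ht] at h
    obtain ⟨ha, hb⟩ := aux_exp ht
    calc ‖screwZeroExpansion t z‖ ≤ (Real.exp (t / 2) + 1) * Cz := h
      _ ≤ 2 * Cz * (t + 1) * Real.exp t := by nlinarith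
  -- (g) the combined `e^{t Im z}`-sized terms: `(iz)⁻¹ · (−E/(E−1)) · tail → (iz)⁻¹ · (−1) · 0`
  have hT : Tendsto (fun t : ℝ ↦ (I * z)⁻¹ * (-(cexp (-(I * z * t)) / (cexp (-(I * z * t)) - 1)) *
      (L - S t))) atTop (𝓝 ((I * z)⁻¹ * (-1 * 0))) := by
    have htail : Tendsto (fun t : ℝ ↦ L - S t) atTop (𝓝 0) := by
      rw [hL, hS]; exact tendsto_LSeries_tail hs
    exact tendsto_const_nhds.mul ((tendsto_cexp_div hz0).neg.mul htail)
  have hlim := (((((h1.add h2).add h3).sub h5).sub h6).sub hP).add hT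
  have e0 : (0 : ℂ) + 0 + 0 - 0 - 0 - 0 + (I * z)⁻¹ * (-1 * 0) = 0 := by ring
  rw [e0] at hlim
  refine hlim.congr' ?_
  filter_upwards [eventually_gt_atTop (0 : ℝ)] with t ht
  rw [hdec t ht]
  ring

/-- **Pointwise pinning.** If, for some `z` with `Im z > 1`, `𝔓_t(z) − P_t(z) = C·(e^{−izt} − 1)` for
all `t > 0` (this is what the explicit formula gives, TeX l.960–975), then `C = 0`, i.e.
`𝔓_t(z) = P_t(z)` for all `t > 0`. [cite: Suzuki2025WeilHilbertSpace, Prop. 3.1 proof (TeX l.794–980)] -/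
theorem screwP_eq_of_sub_eq_const_mul {z : ℂ} (hz : 1 < z.im) {C : ℂ}
    (hC : ∀ t : ℝ, 0 < t → screwP t z - screwZeroExpansion t z = C * (cexp (-(I * z * t)) - 1))
    {t : ℝ} (ht : 0 < t) : screwP t z = screwZeroExpansion t z := by
  have hne : ∀ t : ℝ, 0 < t → cexp (-(I * z * t)) - 1 ≠ 0 := by
    intro t ht h
    rw [sub_eq_zero] at h
    have hn := norm_cexp_neg_I_mul z t
    rw [h, norm_one] at hn
    have : 0 < z.im * t := mul_pos (by linarith) ht
    have := Real.one_lt_exp_iff.2 this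
    linarith
  have hconst : Tendsto (fun t : ℝ ↦ (screwP t z - screwZeroExpansion t z) / (cexp (-(I * z * t)) - 1))
      atTop (𝓝 C) := by
    refine (tendsto_const_nhds (x := C)).congr' ?_
    filter_upwards [eventually_gt_atTop (0 : ℝ)] with t ht
    rw [hC t ht, mul_div_assoc, div_self (hne t ht), mul_one]
  have hC0 : C = 0 := tendsto_nhds_unique hconst (tendsto_sub_div hz)
  have h := hC t ht
  rwa [hC0, zero_mul, sub_eq_zero] at h

end ScrewPinning

/-- RH-FREE · **CJM Prop 3.1 from the explicit formula for the compactly supported combinations.**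
If for every `z` in some upper half-plane `Im z > c` the difference `𝔓_t(z) − P_t(z)` is a
`t`-independent multiple of `e^{−izt} − 1` on `t > 0` — which is what Weil's explicit formula (3.3)
applied to `c_tφ_{z,t} − c_{t′}φ_{z,t′}` yields (TeX l.791–975) — then `𝔓_t = P_t` as typed
(`Suzuki2025_prop31`): the multiple vanishes by `ScrewPinning.tendsto_sub_div` (`t → +∞`), and the
identity theorem (`Suzuki2025_prop31_of_im_gt`) does the rest.
[cite: Suzuki2025WeilHilbertSpace, Prop. 3.1 and its proof (TeX l.789–980)] -/
theorem Suzuki2025_prop31_of_sub_eq_const_mul_of_im_gt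
    (h : ∃ c : ℝ, ∀ z : ℂ, c < z.im → ∃ C : ℂ, ∀ t : ℝ, 0 < t →
      screwP t z - screwZeroExpansion t z = C * (cexp (-(I * z * t)) - 1)) :
    Suzuki2025_prop31 := by
  obtain ⟨c, hc⟩ := h
  refine Suzuki2025_prop31_of_im_gt fun t ht ↦ ⟨max c 1, fun z hz ↦ ?_⟩
  have hz1 : 1 < z.im := lt_of_le_of_lt (le_max_right c 1) hz
  obtain ⟨C, hC⟩ := hc z (lt_of_le_of_lt (le_max_left c 1) hz)
  exact ScrewPinning.screwP_eq_of_sub_eq_const_mul hz1 hC ht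

/-- RH-FREE · the `c = 1` case of `Suzuki2025_prop31_of_sub_eq_const_mul_of_im_gt`: a `t`-independent
`(𝔓_t(z) − P_t(z))/(e^{−izt} − 1)` on `t > 0` for every `z` with `Im z > 1` implies CJM Prop 3.1 as
typed. [cite: Suzuki2025WeilHilbertSpace, Prop. 3.1 and its proof (TeX l.789–980)] -/
theorem Suzuki2025_prop31_of_sub_eq_const_mul
    (h : ∀ z : ℂ, 1 < z.im → ∃ C : ℂ, ∀ t : ℝ, 0 < t →
      screwP t z - screwZeroExpansion t z = C * (cexp (-(I * z * t)) - 1)) :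
    Suzuki2025_prop31 :=
  Suzuki2025_prop31_of_sub_eq_const_mul_of_im_gt ⟨1, h⟩

end Literature.NumberTheory.LFunctions

end
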